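import Summits.ABC.StewartYu.PadicG3TwoKStep
import HarnessLib

/-!
# Cell abc-stewartyu, Gen-3 frame at `p = 2` (crux `Y07Two`, stmt-ABC-19659), layer F4c: the INNER CHAIN of
# extrapolation steps inside one level (Yu 2013 Lemma 5.2: sub-steps `J = 1, …, r`)

`Summits/ABC/StewartYu/PadicG3TwoKChain.lean` — cell `abc-stewartyu` (HOME `run/shared/lean/pub/abc-stewartyu/`),
route `PadicPrimesKummerThird`, seat p3 (g5), F-two LEAD (layer plan HOME/p3/memo-09 §3, F4).  One theorem
on the M2 datum `TwoSetup`; twin of `PadicTwoMain.kchain3`.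

From the vanishing of the rational values `g3φ τ x` at `|x| ≤ N₀`, `|τ| < T` (the Siegel step at level `0`,
or the previous level's output), `k` applications of the k-step `PadicG3TwoKStep.g3_kstep` along an
arbitrary increasing RANGE SCHEDULE `Nsched` (Yu: `q^J S`) give the vanishing at `|x| ≤ Nsched k`,
`|τ| < T − k·t`, provided the record's numerical inequality of each sub-step holds (`hfinal k`) — the
hypothesis `KFinal`-shape of the M2 chain, with the Liouville datum `K(x, τ)` of `PadicG3TwoValues`.

WHAT THIS IS NOT: no schedule or parameter is chosen here (record); no Kummer descent (F5); no crux moves.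

References: K. Yu, Acta Math. 211 (2013), Lemma 5.2; K. Yu, Acta Arith. 53 (1989), §3 Lemma 3.3.
-/

noncomputable section

open Finset Polynomial
open Literature.NumberTheory.Transcendental
open Literature.NumberTheory.Transcendental.PadicCW77 (condExp)
open Literature.NumberTheory.Transcendental.CW77.Setup (Tau tauNorm)

namespace Summit.ABC.StewartYu

namespace TwoSetup

variable (S : TwoSetup) {ι : Type*} (R : ι → ℚ[X]) (u : ι → Fin S.d → ℤ) (uθ : ι → ℤ)

/-- **The inner chain of the Gen-3 `2`-adic frame** (Yu 2013 Lemma 5.2): for every `k`, the rational values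
`g3φ τ x` vanish for `|x| ≤ Nsched k` and `|τ| < T − k·t`, by `k` k-steps from the vanishing at
`|x| ≤ Nsched 0`, `|τ| < T`. [cite: Yu2013, Lemma 5.2] -/
theorem g3_kchain (B : Finset ι) (p : ι → ℤ) {T t : ℕ} (ht : 1 ≤ t) (Nsched : ℕ → ℕ)
    {Bw : ℝ} (hBw0 : 0 ≤ Bw) (hBw : ∀ i ∈ B, ∀ t₀ k, ‖(hw R i t₀).coeff k‖ * 4 ^ k ≤ Bw)
    (hzero0 : ∀ x : ℤ, |x| ≤ (Nsched 0 : ℤ) → ∀ τ : Tau S.d, tauNorm τ < T →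
      S.g3φ R u uθ B p τ x = 0)
    {Dbox : Fin S.d → ℕ} {Dθ : ℕ} (hu : ∀ i ∈ B, ∀ j, |u i j| ≤ (Dbox j : ℤ))
    (huθ : ∀ i ∈ B, |uθ i| ≤ (Dθ : ℤ))
    (den₀ : ℤ → Tau S.d → ℕ) (hden₀ : ∀ x τ, 1 ≤ den₀ x τ) {M₀ : ℤ}
    (hR : ∀ (x : ℤ) (τ : Tau S.d), ∀ i ∈ B,
      ∃ z₀ : ℤ, (den₀ x τ : ℚ) * (hasseDeriv τ.1 (R i)).eval (x : ℚ) = z₀ ∧ |z₀| ≤ M₀)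
    {Xb : ℤ} (hX : ∀ i ∈ B, ∀ j, |S.dirScalar (u i) (uθ i) j| ≤ Xb) {P : ℤ} (hP : ∀ i ∈ B, |p i| ≤ P)
    (K : ℤ → Tau S.d → ℝ) (hK0 : ∀ x τ, 0 < K x τ)
    (hK : ∀ (x : ℤ) (τ : Tau S.d), (B.card : ℝ) * P * (M₀ * (Xb : ℝ) ^ (∑ j, τ.2 j) *
      ((MonomialDen.monDen S.toQ.all (S.boxExp Dbox Dθ x) : ℝ)) ^ 2) ≤ K x τ)
    (hfinal : ∀ k, ∀ x₁ : ℤ, |x₁| ≤ (Nsched (k + 1) : ℤ) → ∀ τ : Tau S.d, tauNorm τ + t ≤ T - k * t →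
      max (Bw * ‖S.Λ₀‖ * (2 : ℝ) ^ t * (2 : ℝ) ^ condExp 2 (2 * Nsched k + 1) t)
        (Bw / (4 : ℝ) ^ ((2 * Nsched k + 1) * t)) < 1 / K x₁ τ) :
    ∀ k, ∀ x : ℤ, |x| ≤ (Nsched k : ℤ) → ∀ τ : Tau S.d, tauNorm τ < T - k * t →
      S.g3φ R u uθ B p τ x = 0 := by
  intro k
  induction k with
  | zero =>
    intro x hx τ hτ
    exact hzero0 x hx τ (by simpa using hτ)
  | succ k ih =>
    intro x hx τ hτ
    have key := S.g3_kstep R u uθ B p (N := Nsched k) (N' := Nsched (k + 1)) (Tlo := T - k * t) ht hBw0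
      hBw ih hu huθ den₀ hden₀ hR hX hP K hK0 hK (hfinal k)
    refine key x hx τ ?_
    rw [Nat.succ_mul] at hτ
    omega

end TwoSetup

end Summit.ABC.StewartYu

end
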